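import Summits.CriticalPhenomena.PercolationContinuityZ3.Theorems.PercNearOneGluingNearOneGluingBhkLogSupermodular
import Summits.CriticalPhenomena.PercolationContinuityZ3.Theorems.PercNearOneGluingNearOneGluingBhkClusterAssociation
import Summits.CriticalPhenomena.PercolationContinuityZ3.Theorems.PercNearOneGluingNearOneGluingTerminalSeparation
import Summits.CriticalPhenomena.PercolationContinuityZ3.Theorems.PercNearOneGluingNearOneGluingWeightContinuity
import Summits.CriticalPhenomena.PercolationContinuityZ3.Theorems.PercNearOneGluingNearOneGluingSingleFinger
import Summits.CriticalPhenomena.PercolationContinuityZ3.Theorems.PercNearOneGluingNearOneGluingDyadicThinning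
import HarnessLib

/-!
# Crux `PercNearOneGluing.NearOneGluing` (stmt-CriticalPhenomena-4574), line `bhk-dyadic-thinning` —
# the line's theorem-grade output: WINDOW BOUND, LOG GLUING, and Kozma–Nitzan Conjecture 3 on the
# exponential range `|A| < 2^L`

Lead prover-line-stmt-CriticalPhenomena-4574-0, 2026-08-16.  Composes the six landed stubs of the line
(`stub_bhkLogSupermodular` = BHK Thm 1.1, `stub_bhkClusterAssociation` = Thm 1.1 ⇒ Thm 1.3,
`stub_terminalSeparation`, `stub_weightContinuity`, `stub_singleFinger` = KN Lemma 2 with singleton blocks,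
`stub_dyadicThinning`) into UNCONDITIONAL theorems on every finite weighted graph
(`μ = prodBernoulli w` on bond configurations of the complete graph on `Fin n`, `N(ω) = |{a ∈ A : o ↔ a}|`):

* `windowBound` — `μ{o ↮ b ∧ K ≤ N < K·2^L} ≤ 16·L·t` whenever `μ(a ↮ b) ≤ t` for all `a ∈ A` (`K ≥ 1`).
* `logGluing` — `μ(o ↮ b) ≤ μ(o ↮ A) + 16·(⌊log₂ |A|⌋ + 1)·t`: Kozma–Nitzan's gluing with a LOGARITHMIC
  (not linear) loss in `|A|` — the first `|A|`-sublinear gluing inequality in the tree.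
* `nearOneGluing_of_card_lt_two_pow` — Conjecture 3 (the crux, arXiv:2401.12397 p. 15) holds UNIFORMLY
  over all relay sets with `|A| < 2^L`, with the explicit `δ = ε / (16 L + 2)`; equivalently a counterexample
  to the crux at `(ε, δ)` needs `|A| ≥ 2^{(ε − 2δ)/(16 δ)}`.

What is NOT here: the residual of the line (`stub_doomWindow`, the crux restricted to the doom window
`2^{⌈1/δ⌉} ≤ N ≤ |A|·2^{−⌈1/δ⌉}`), which is equivalent to the crux given the above and is open.
-/

namespace Summit.CriticalPhenomena.PercolationContinuityZ3.Theorems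

open scoped BigOperators Classical
open MeasureTheory Set
open Literature.Probability.LatticeModels (prodBernoulli)
open Literature.Probability.Percolation (openConn measurableSet_openConn_holds)

/-- **Window bound** (unconditional; line `bhk-dyadic-thinning`, stubs 1–6 composed): on every finite
weighted graph, if every relay point `a ∈ A` has `μ(a ↮ b) ≤ t`, then for every `K ≥ 1` and `L`,
`μ{o ↮ b ∧ K ≤ N < K·2^L} ≤ 16·L·t`, where `N = |{a ∈ A : o ↔ a}|` — `16 t` per dyadic scale of the
footprint, nothing else depending on `A`. Sources: van den Berg–Häggström–Kahn 2006 Thm 1.1/1.3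
(arXiv:math/0408176), Kozma–Nitzan arXiv:2401.12397 Lemma 2. [folklore] -/
theorem windowBound :
    ∀ (n : ℕ) (w : Sym2 (Fin n) → unitInterval) (A : Finset (Fin n)) (o b : Fin n) (t : ℝ) (K L : ℕ),
      0 ≤ t → 1 ≤ K →
      (∀ a ∈ A, (Literature.Probability.LatticeModels.prodBernoulli w).real (Literature.Probability.Percolation.openConn a b)ᶜ ≤ t) →
      (Literature.Probability.LatticeModels.prodBernoulli w).real
          {ω | ω ∉ Literature.Probability.Percolation.openConn o b ∧ K ≤ (A.filter fun a => ω ∈ Literature.Probability.Percolation.openConn o a).card ∧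
            (A.filter fun a => ω ∈ Literature.Probability.Percolation.openConn o a).card < K * 2 ^ L} ≤ 16 * (L : ℝ) * t :=
  stub_dyadicThinning
    (stub_singleFinger (stub_terminalSeparation (stub_bhkClusterAssociation stub_bhkLogSupermodular))
      stub_weightContinuity)

/-- **Log gluing** (unconditional): on every finite weighted graph and for every relay set `A`,
`μ(o ↮ b) ≤ μ(o ↮ A) + 16·(⌊log₂ |A|⌋ + 1)·t` whenever `μ(a ↮ b) ≤ t` for all `a ∈ A`.
Proof: split the bad event by the footprint `N`: `N = 0` is `{o ↮ A}`; `1 ≤ N ≤ |A| < 2^{⌊log₂|A|⌋+1}` is one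
window of `⌊log₂|A|⌋ + 1` dyadic scales (`windowBound` with `K = 1`). [folklore] -/
theorem logGluing :
    ∀ (n : ℕ) (w : Sym2 (Fin n) → unitInterval) (A : Finset (Fin n)) (o b : Fin n) (t : ℝ), 0 ≤ t →
      (∀ a ∈ A, (Literature.Probability.LatticeModels.prodBernoulli w).real (Literature.Probability.Percolation.openConn a b)ᶜ ≤ t) →
      (Literature.Probability.LatticeModels.prodBernoulli w).real (Literature.Probability.Percolation.openConn o b)ᶜ ≤
        (Literature.Probability.LatticeModels.prodBernoulli w).real (⋃ a ∈ A, Literature.Probability.Percolation.openConn o a)ᶜ + 16 * ((Nat.log 2 A.card + 1 : ℕ) : ℝ) * t := by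
  intro n w A o b t ht hB
  set μ := prodBernoulli w with hμ
  set L : ℕ := Nat.log 2 A.card + 1 with hL
  have hAL : A.card < 2 ^ L := Nat.lt_pow_succ_log_self (by norm_num) _
  set P0 : Set (Set (Sym2 (Fin n))) := (⋃ a ∈ A, openConn o a)ᶜ with hP0
  set P1 : Set (Set (Sym2 (Fin n))) :=
    {ω | ω ∉ openConn o b ∧ 1 ≤ (A.filter fun a => ω ∈ openConn o a).card ∧
      (A.filter fun a => ω ∈ openConn o a).card < 1 * 2 ^ L} with hP1
  have h1 : μ.real P1 ≤ 16 * (L : ℝ) * t := windowBound n w A o b t 1 L ht le_rfl hB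
  have hcover : (openConn o b)ᶜ ⊆ P0 ∪ P1 := by
    intro ω hω
    have hωb : ω ∉ openConn o b := hω
    by_cases hz : (A.filter fun a => ω ∈ openConn o a).card = 0
    · refine Or.inl ?_
      rw [hP0, Set.mem_compl_iff, Set.mem_iUnion₂]
      rintro ⟨a, ha, hoa⟩
      have : a ∈ A.filter fun a => ω ∈ openConn o a := Finset.mem_filter.2 ⟨ha, hoa⟩
      rw [Finset.card_eq_zero] at hz
      simp [hz] at this
    · refine Or.inr ⟨hωb, Nat.one_le_iff_ne_zero.2 hz, ?_⟩
      have hNle : (A.filter fun a => ω ∈ openConn o a).card ≤ A.card := Finset.card_filter_le _ _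
      simpa using lt_of_le_of_lt hNle hAL
  calc μ.real (openConn o b)ᶜ ≤ μ.real (P0 ∪ P1) := measureReal_mono hcover
    _ ≤ μ.real P0 + μ.real P1 := measureReal_union_le _ _
    _ ≤ μ.real P0 + 16 * ((Nat.log 2 A.card + 1 : ℕ) : ℝ) * t := by rw [← hL]; linarith

/-- **Kozma–Nitzan Conjecture 3 on the exponential range** (unconditional): for every `ε > 0` and every
`L : ℕ`, with `δ := ε / (16 L + 2)`, EVERY finite weighted graph and every relay set `A` with `|A| < 2^L`
satisfy the crux: `μ(o ↔ A) > 1 − δ` and `μ(a ↔ b) > 1 − δ` for all `a ∈ A` imply `μ(o ↔ b) > 1 − ε`.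
Equivalently, a counterexample to `PercNearOneGluing.NearOneGluing` at `(ε, δ)` must have
`⌊log₂ |A|⌋ + 1 > (ε − 2δ)/(16δ)`. (Kozma–Nitzan arXiv:2401.12397 Conj. 3 is the same statement with
`δ` independent of `|A|`; for `|A| ≤ k` the union bound gives `δ = ε/(k+1)` — here `k = 2^L − 1` costs only
`δ = ε/(16 L + 2)`.) [folklore] -/
theorem nearOneGluing_of_card_lt_two_pow :
    ∀ ε : ℝ, 0 < ε → ∀ L : ℕ, ∃ δ : ℝ, 0 < δ ∧
      ∀ (n : ℕ) (w : Sym2 (Fin n) → unitInterval) (A : Finset (Fin n)) (o b : Fin n),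
        A.card < 2 ^ L →
        1 - δ < (Literature.Probability.LatticeModels.prodBernoulli w).real (⋃ a ∈ A, Literature.Probability.Percolation.openConn o a) →
        (∀ a ∈ A, 1 - δ < (Literature.Probability.LatticeModels.prodBernoulli w).real (Literature.Probability.Percolation.openConn a b)) →
        1 - ε < (Literature.Probability.LatticeModels.prodBernoulli w).real (Literature.Probability.Percolation.openConn o b) := by
  intro ε hε L
  have hL0 : (0 : ℝ) ≤ L := Nat.cast_nonneg L
  refine ⟨ε / (16 * (L : ℝ) + 2), by positivity, ?_⟩
  intro n w A o b hA hoA hAb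
  set δ : ℝ := ε / (16 * (L : ℝ) + 2) with hδ
  have hδpos : 0 < δ := by positivity
  set μ := prodBernoulli w with hμ
  have hmeas : ∀ x y : Fin n, MeasurableSet (openConn x y : Set (Set (Sym2 (Fin n)))) :=
    fun x y => measurableSet_openConn_holds x y
  -- hypotheses in complement form
  have hAc : μ.real (⋃ a ∈ A, openConn o a)ᶜ < δ := by
    rw [measureReal_compl (Finset.measurableSet_biUnion A fun a _ => hmeas o a), probReal_univ]
    linarith
  have hBc : ∀ a ∈ A, μ.real (openConn a b)ᶜ ≤ δ := by
    intro a ha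
    rw [measureReal_compl (hmeas a b), probReal_univ]
    linarith [hAb a ha]
  -- degenerate case `A = ∅`: the first hypothesis forces `δ > 1`, hence `ε > 2`, and the goal is trivial
  rcases Nat.eq_zero_or_pos A.card with h0 | hpos
  · have hA0 : A = ∅ := Finset.card_eq_zero.1 h0
    subst hA0
    have hδ1 : 1 < δ := by
      have : μ.real (⋃ a ∈ (∅ : Finset (Fin n)), openConn o a) = 0 := by simp
      linarith [this ▸ hoA]
    have hε2 : 16 * (L : ℝ) + 2 < ε := by
      have hpos : (0 : ℝ) < 16 * (L : ℝ) + 2 := by positivity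
      have := (lt_div_iff₀ hpos).1 (hδ ▸ hδ1)
      linarith
    have h0le : (0 : ℝ) ≤ μ.real (openConn o b) := measureReal_nonneg
    linarith
  -- log gluing with t = δ, and ⌊log₂ |A|⌋ + 1 ≤ L
  have hlog : Nat.log 2 A.card + 1 ≤ L := (Nat.log_lt_iff_lt_pow (by norm_num) hpos.ne').2 hA
  have hglue := logGluing n w A o b δ hδpos.le hBc
  have hcast : ((Nat.log 2 A.card + 1 : ℕ) : ℝ) ≤ (L : ℝ) := by exact_mod_cast hlog
  have hkey : δ * (16 * (L : ℝ) + 2) = ε := by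
    rw [hδ]; field_simp
  have hfin : μ.real (openConn o b)ᶜ < ε := by
    have h16 : 16 * ((Nat.log 2 A.card + 1 : ℕ) : ℝ) * δ ≤ 16 * (L : ℝ) * δ := by
      have := mul_le_mul_of_nonneg_right hcast hδpos.le
      nlinarith
    nlinarith [hglue, hAc, h16, hkey, hδpos, hL0]
  rw [measureReal_compl (hmeas o b), probReal_univ] at hfin
  linarith

end Summit.CriticalPhenomena.PercolationContinuityZ3.Theorems
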